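import Summits.HubbardSuperconductivity.HubbardSuperconductivity.Theorems.AnisotropyChordTransferFibre3FinXDCheck

/-!
# Route `AnisotropyChord` / H0 rotor rung: FIN per-`L` row-D (KT-2a″) SUB-CELL facts, `L = 9` (0–5)

Row-D facts `xdCellAny0 9 (49/50) la lb aD = true` on quarter sub-cells of the combined cells whose side condition needs `aD ≈ .04` (mechhunt STATUS p3 g7 REPORT 3).
Prover seat `hubbard-h0-rotor-p3` g7; helper for piece A = stmt-HubbardSuperconductivity-23918 of rung 19089 (`--supports`, helper class).
WHAT THIS IS NOT: nothing here proves superconductivity in the Hubbard model (rotor TARGET as worded stays FALSE, g15 verdict); kernel facts /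
assembly for ONE conditional reduction at one `L`.  No sorry.
-/

set_option linter.dupNamespace false
set_option autoImplicit false

namespace Summit.HubbardSuperconductivity.HubbardSuperconductivity.Theorems.AnisotropyChord.Transfer.Fibre3

namespace FinXD

/-- row-D sub-cell `[10237561684212455, 10301546444738783]` of `L = 9`. [folklore] -/
theorem xd9s_109_0 : xdCellAny0 9 (49/50 : ℚ) 10237561684212455 10301546444738783 (1/25 : ℚ) = true := by decide +kernel

/-- row-D sub-cell `[10301546444738783, 10365531205265111]` of `L = 9`. [folklore] -/
theorem xd9s_109_1 : xdCellAny0 9 (49/50 : ℚ) 10301546444738783 10365531205265111 (1/25 : ℚ) = true := by decide +kernel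

/-- row-D sub-cell `[10365531205265111, 10429515965791439]` of `L = 9`. [folklore] -/
theorem xd9s_109_2 : xdCellAny0 9 (49/50 : ℚ) 10365531205265111 10429515965791439 (1/25 : ℚ) = true := by decide +kernel

/-- row-D sub-cell `[10429515965791439, 10493500726317767]` of `L = 9`. [folklore] -/
theorem xd9s_109_3 : xdCellAny0 9 (49/50 : ℚ) 10429515965791439 10493500726317767 (1/25 : ℚ) = true := by decide +kernel

/-- row-D sub-cell `[10493500726317767, 10559085105857253]` of `L = 9`. [folklore] -/
theorem xd9s_110_0 : xdCellAny0 9 (49/50 : ℚ) 10493500726317767 10559085105857253 (1/25 : ℚ) = true := by decide +kernel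

/-- row-D sub-cell `[10559085105857253, 10624669485396740]` of `L = 9`. [folklore] -/
theorem xd9s_110_1 : xdCellAny0 9 (49/50 : ℚ) 10559085105857253 10624669485396740 (1/25 : ℚ) = true := by decide +kernel

end FinXD

end Summit.HubbardSuperconductivity.HubbardSuperconductivity.Theorems.AnisotropyChord.Transfer.Fibre3
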